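import Literature.Probability.LatticeModels.WeakBeurlingEstimate
import HarnessLib

/-!
# The barrier step one row from the near side: gambler's ruin in a lattice rectangle

Topic `Literature/Probability/LatticeModels`; a complement to §3 of `WeakBeurlingEstimate.lean`
(the single-mode barrier `WeakBeurling.barrierFn` of a lattice rectangle in any of the eight frames
`(i, s, a, b)`, and `WeakBeurling.barrier_step`: a function superharmonic on `D ⊆` rectangle,
nonnegative on `∂D` and `≥ γ` at the points of `∂D` inside the rectangle or on its far side, is
`≥ γ c_b` on the zone `X/(L+1) ∈ [1/4, 3/4]`, `Y ≥ (L+1)/5`). Here the zone is extended down to the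
first row `Y ≥ 1` at the price of the factor `1/(L+1)`: **`ψ ≥ γ · 2e^{-4π}/(L+1)`**
(`barrier_step_near`) — the lattice form of the gambler's-ruin estimate "a walk started next to the
absorbing side of an `L × M` rectangle reaches the far side with probability `≍ 1/L`", which is the
`c/k` in Duminil-Copin–Hongler–Nolin's Lemma 10 (arXiv:0912.4253, §3.2: "standard results on
simple random walks … gambler's ruin type estimates"). Everything is PROVED; no named fact;
[folklore]. Inputs: `le_modeProfile_ratio_first` (`φ₁(1)/φ₁(M+1) ≥ 4e^{-4π}/(L+1)` for
`M + 1 ≤ 4(L+1)`) and `half_le_sin` of `BoxSineHarmonic.lean`, the monotonicity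
`WeakBeurling.dstProfile_mono_nat`, and the comparison principle `le_of_sub_super_of_boundary`.
Integer-coordinate forms for lattice users: `barrier_step_near_int`, `barrier_step_near_explicit`.

## References

* G. Lawler, V. Limic, *Random Walk: A Modern Introduction* (2010), §5.1 (gambler's ruin), §8.1
  (eigenfunctions of the rectangle) — bib key `LawlerLimic2010`.
* H. Duminil-Copin, C. Hongler, P. Nolin, Comm. Pure Appl. Math. 64 (2011), §3.2, Lemmas 9–10 —
  bib key `DuminilCopinHonglerNolin2011`.
-/

noncomputable section

namespace Literature.Probability.LatticeModels

namespace WeakBeurling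

open Real

/-- The near-side constant of the barrier: `2 e^{-4π}/(L+1)`. [folklore] -/
def barrierNearConst (L : ℕ) : ℝ := 2 * Real.exp (-(4 * π)) / ((L : ℝ) + 1)

/-- `2e^{-4π}/(L+1) > 0`. [folklore] -/
theorem barrierNearConst_pos (L : ℕ) : 0 < barrierNearConst L := by
  unfold barrierNearConst; positivity

/-- **The barrier one row from the near side**: for `X/(L+1) ∈ [1/4, 3/4]`, `Y ≥ 1` and aspect
`M + 1 ≤ 4(L+1)`, `barrierFn ≥ 2e^{-4π}/(L+1)` (`sin ≥ 1/2` and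
`φ₁(Y)/φ₁(M+1) ≥ φ₁(1)/φ₁(M+1) ≥ 4e^{-4π}/(L+1)`). [folklore] -/
theorem barrierNearConst_le_barrierFn (i : Fin 2) (s a b : ℤ) {L M : ℕ} (hL : 1 ≤ L) (hM : M + 1 ≤ 4 * (L + 1))
    {z : Site 2} (hX0 : ((L : ℝ) + 1) / 4 ≤ ((z i.rev - a : ℤ) : ℝ)) (hX1 : ((z i.rev - a : ℤ) : ℝ) ≤ 3 * ((L : ℝ) + 1) / 4)
    (hY : 1 ≤ s * (z i - b)) : barrierNearConst L ≤ barrierFn i s a b L M z := by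
  unfold barrierFn barrierNearConst
  have hs := half_le_dstSin_one (L := L) hX0 hX1
  set Y := s * (z i - b) with hYdef
  have hY0 : 0 ≤ Y := by omega
  have hYnat : Y = ((Y.toNat : ℕ) : ℤ) := (Int.toNat_of_nonneg hY0).symm
  have hpos : 0 < dstProfile L 1 (M + 1) := dstProfile_pos le_rfl hL (by positivity)
  have hr : 4 * Real.exp (-(4 * π)) / ((L : ℝ) + 1) ≤ dstProfile L 1 Y / dstProfile L 1 (M + 1) := by
    refine (le_modeProfile_ratio_first hL hM).trans ?_
    refine div_le_div_of_nonneg_right ?_ hpos.le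
    rw [hYnat, show (1 : ℤ) = ((1 : ℕ) : ℤ) by norm_num]
    exact dstProfile_mono_nat (by omega)
  have h0 : 0 ≤ 4 * Real.exp (-(4 * π)) / ((L : ℝ) + 1) := by positivity
  calc 2 * Real.exp (-(4 * π)) / ((L : ℝ) + 1) = 1 / 2 * (4 * Real.exp (-(4 * π)) / ((L : ℝ) + 1)) := by ring
    _ ≤ dstSin L 1 (z i.rev - a) * (dstProfile L 1 Y / dstProfile L 1 (M + 1)) :=
        mul_le_mul hs hr h0 (le_trans (by norm_num) hs)

/-- **The barrier step one row from the near side (gambler's ruin in a rectangle).** Let `D` lie in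
the rectangle `1 ≤ X ≤ L`, `1 ≤ Y ≤ M` of the frame `(i, s, a, b)` (`L ≥ 1`, `M + 1 ≤ 4(L+1)`),
`ψ` superharmonic on `D`, nonnegative on `∂D`, and `≥ γ ≥ 0` at the points of `∂D` inside the
rectangle or on its far side `Y = M + 1`. Then at every `z ∈ D` with `X/(L+1) ∈ [1/4, 3/4]` (any
`Y ≥ 1`), `ψ z ≥ γ · 2e^{-4π}/(L+1)`. [folklore] -/
theorem barrier_step_near (i : Fin 2) {s : ℤ} (hs : s = 1 ∨ s = -1) (a b : ℤ) {L M : ℕ} (hL : 1 ≤ L) (hM : M + 1 ≤ 4 * (L + 1))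
    {D : Set (Site 2)} (hDfin : D.Finite)
    (hD : ∀ z ∈ D, 1 ≤ z i.rev - a ∧ z i.rev - a ≤ L ∧ 1 ≤ s * (z i - b) ∧ s * (z i - b) ≤ M)
    {ψ : Site 2 → ℝ} (hψ : IsLatticeSuperharmonicOn ψ D) {γ : ℝ} (hγ : 0 ≤ γ)
    (h0 : ∀ w ∈ latticeOuterBoundary D, 0 ≤ ψ w)
    (h1 : ∀ w ∈ latticeOuterBoundary D, 1 ≤ w i.rev - a → w i.rev - a ≤ L → 1 ≤ s * (w i - b) → s * (w i - b) ≤ M + 1 → γ ≤ ψ w)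
    {z : Site 2} (hz : z ∈ D)
    (hX0 : ((L : ℝ) + 1) / 4 ≤ ((z i.rev - a : ℤ) : ℝ)) (hX1 : ((z i.rev - a : ℤ) : ℝ) ≤ 3 * ((L : ℝ) + 1) / 4) :
    γ * barrierNearConst L ≤ ψ z := by
  set v := barrierFn i s a b L M with hv
  have hsub : IsLatticeSubharmonicOn (fun x => γ * v x) D := fun x _ => by
    rw [latticeLaplacian_const_mul, hv, latticeLaplacian_barrierFn i hs]; simp
  have hb : ∀ w ∈ latticeOuterBoundary D, (fun x => γ * v x) w ≤ ψ w + 0 := by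
    intro w hw
    rw [add_zero]
    obtain ⟨-, u, hu, hadj⟩ := mem_latticeOuterBoundary_iff.1 hw
    obtain ⟨hu1, hu2, hu3, hu4⟩ := hD u hu
    have hc := frame_coords_of_adj i hs a b hadj
    by_cases hzero : w i.rev - a = 0 ∨ w i.rev - a = L + 1 ∨ s * (w i - b) = 0
    · show γ * v w ≤ ψ w
      rw [hv, barrierFn_eq_zero i s a b L M hzero, mul_zero]
      exact h0 w hw
    · have hin : 1 ≤ w i.rev - a ∧ w i.rev - a ≤ L ∧ 1 ≤ s * (w i - b) ∧ s * (w i - b) ≤ M + 1 := by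
        simp only [not_or] at hzero
        omega
      have hle : v w ≤ 1 := (barrierFn_mem_Icc i s a b hL (by omega) (by omega) (by omega) hin.2.2.2).2
      show γ * v w ≤ ψ w
      calc γ * v w ≤ γ * 1 := mul_le_mul_of_nonneg_left hle hγ
        _ = γ := mul_one γ
        _ ≤ ψ w := h1 w hw hin.1 hin.2.1 hin.2.2.1 hin.2.2.2
  have key := le_of_sub_super_of_boundary hDfin hsub hψ hb z hz
  rw [add_zero] at key
  calc γ * barrierNearConst L ≤ γ * v z :=
        mul_le_mul_of_nonneg_left (barrierNearConst_le_barrierFn i s a b hL hM hX0 hX1 (hD z hz).2.2.1) hγ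
    _ ≤ ψ z := key

/-- `barrier_step_near` with the zone hypothesis in integer form: `L + 1 ≤ 4X` and `4X ≤ 3(L+1)`
for `X = z i.rev - a` (the form in which lattice users meet it). [folklore] -/
theorem barrier_step_near_int (i : Fin 2) {s : ℤ} (hs : s = 1 ∨ s = -1) (a b : ℤ) {L M : ℕ} (hL : 1 ≤ L) (hM : M + 1 ≤ 4 * (L + 1))
    {D : Set (Site 2)} (hDfin : D.Finite)
    (hD : ∀ z ∈ D, 1 ≤ z i.rev - a ∧ z i.rev - a ≤ L ∧ 1 ≤ s * (z i - b) ∧ s * (z i - b) ≤ M)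
    {ψ : Site 2 → ℝ} (hψ : IsLatticeSuperharmonicOn ψ D) {γ : ℝ} (hγ : 0 ≤ γ)
    (h0 : ∀ w ∈ latticeOuterBoundary D, 0 ≤ ψ w)
    (h1 : ∀ w ∈ latticeOuterBoundary D, 1 ≤ w i.rev - a → w i.rev - a ≤ L → 1 ≤ s * (w i - b) → s * (w i - b) ≤ M + 1 → γ ≤ ψ w)
    {z : Site 2} (hz : z ∈ D) (hX0 : (L : ℤ) + 1 ≤ 4 * (z i.rev - a)) (hX1 : 4 * (z i.rev - a) ≤ 3 * ((L : ℤ) + 1)) :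
    γ * barrierNearConst L ≤ ψ z := by
  refine barrier_step_near i hs a b hL hM hDfin hD hψ hγ h0 h1 hz ?_ ?_
  · have h : ((L : ℝ) + 1) ≤ 4 * ((z i.rev - a : ℤ) : ℝ) := by exact_mod_cast hX0
    linarith
  · have h : 4 * ((z i.rev - a : ℤ) : ℝ) ≤ 3 * ((L : ℝ) + 1) := by exact_mod_cast hX1
    linarith

/-- The near-side bound made explicit: under the hypotheses of `barrier_step_near_int`,
`ψ z ≥ γ · 2e^{-4π}/(L+1)`. [folklore] -/
theorem barrier_step_near_explicit (i : Fin 2) {s : ℤ} (hs : s = 1 ∨ s = -1) (a b : ℤ) {L M : ℕ} (hL : 1 ≤ L) (hM : M + 1 ≤ 4 * (L + 1))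
    {D : Set (Site 2)} (hDfin : D.Finite)
    (hD : ∀ z ∈ D, 1 ≤ z i.rev - a ∧ z i.rev - a ≤ L ∧ 1 ≤ s * (z i - b) ∧ s * (z i - b) ≤ M)
    {ψ : Site 2 → ℝ} (hψ : IsLatticeSuperharmonicOn ψ D) {γ : ℝ} (hγ : 0 ≤ γ)
    (h0 : ∀ w ∈ latticeOuterBoundary D, 0 ≤ ψ w)
    (h1 : ∀ w ∈ latticeOuterBoundary D, 1 ≤ w i.rev - a → w i.rev - a ≤ L → 1 ≤ s * (w i - b) → s * (w i - b) ≤ M + 1 → γ ≤ ψ w)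
    {z : Site 2} (hz : z ∈ D) (hX0 : (L : ℤ) + 1 ≤ 4 * (z i.rev - a)) (hX1 : 4 * (z i.rev - a) ≤ 3 * ((L : ℤ) + 1)) :
    γ * (2 * Real.exp (-(4 * π)) / ((L : ℝ) + 1)) ≤ ψ z :=
  barrier_step_near_int i hs a b hL hM hDfin hD hψ hγ h0 h1 hz hX0 hX1

end WeakBeurling

end Literature.Probability.LatticeModels
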